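import Summits.CriticalPhenomena.Ising3DConformalLimit.Theorems.FKParityRobustnessFKFourConnectivityDefs
import Summits.CriticalPhenomena.Ising3DConformalLimit.Theorems.FKParityRobustnessFKFourConnectivityHoleDictionary
import Literature.Probability.LatticeModels.RandomClusterConditionalDomination
import Literature.Probability.LatticeModels.RandomClusterProofs
import Literature.Probability.Percolation.PercolationEvents

/-!
# Crux `FKFourConnectivity` (stmt-CriticalPhenomena-11254), line `cluster-hole-opacity`:
# single-site holes are opaque (stub `stub_singleSiteHole`)

On an arbitrary finite graph `G`, for `0 < p < 1`, `q ≥ 1`, vertices `a, b ≠ k` and two edge sets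
`P₁` (joining `a` to `k`) and `P₂` (joining `k` to `b`) touching only at `k`, inside a set
`S ⊆ E(G)` containing every edge of `G` at a vertex touched by `P₁ ∪ P₂`, deleting the edges at
`k` depresses the random-cluster connection probability by a definite factor:
`φ_{G∖k}(a ↔ b) ≤ (1 − (min(p,1−p)/(2q))^{#S}) · φ_G(a ↔ b)`.

Proof.  (1) The closed-outside domain Markov property and FKG
(`rcMeasure_fromEdgeSet_real_le`, Grimmett 2006, Thm. (3.1)(a), Thm. (3.8)) give
`φ_{G∖k}(a ↔ b) ≤ φ_G(a ↔ b without using an edge at k)`.  (2) Finite energy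
(`rcMeasure_real_cylinder_ge'`): the cylinder event "the configuration on `S` is exactly
`P₁ ∪ P₂`" has probability `≥ (min(p,1−p)/(2q))^{#S}`.  (3) That cylinder lies in `{a ↔ b}` but
is disjoint from `{a ↔ b off k}`: an open path from `a` avoiding `k` is confined to the vertices
touched by `P₁` (every edge at such a vertex lies in `S`, the `S`-configuration is exactly
`P₁ ∪ P₂`, and `P₁`, `P₂` meet only at `k`), and `b` is touched by `P₂`, not by `P₁`.
(4) Additivity of `φ_G` over the two disjoint events.

References: G. Grimmett, *The Random-Cluster Model* (2006), Thm. (3.1)(a), Thm. (3.8),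
Thm. (4.17)-type finite-energy bounds.
-/

noncomputable section

open MeasureTheory Finset
open Literature.Probability.LatticeModels Literature.Probability.Percolation

namespace Summit.CriticalPhenomena.Ising3DConformalLimit.Cruxes.FKFourConnectivity.ClusterHoleOpacity

open scoped Classical

/-! ### Finite energy of the random-cluster measure on cylinder events -/

section FiniteEnergy

variable {V : Type*} [Fintype V] [DecidableEq V] (G : SimpleGraph V) [DecidableRel G.Adj]

omit [DecidableEq V] [DecidableRel G.Adj] in
/-- Opening the edges of a finite set `T` lowers the (wired) cluster count by at most `#T`
(each new edge merges at most two clusters). -/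
private theorem clusterCount_le_clusterCount_union_add_card (ω : BondConfig V) (B : Set V)
    (T : Finset (Sym2 V)) : clusterCount ω B ≤ clusterCount (ω ∪ ↑T) B + #T := by
  induction T using Finset.induction_on with
  | empty => simp
  | insert e T heT ih =>
    rw [Finset.coe_insert, Finset.card_insert_of_notMem heT]
    have hstep : ∀ ω' : BondConfig V, clusterCount ω' B ≤ clusterCount (insert e ω') B + 1 := by
      intro ω'
      induction e using Sym2.ind with
      | _ u v =>
        rw [clusterCount, clusterCount, openGraph, openGraph, Set.insert_eq,
          SimpleGraph.fromEdgeSet_union {s(u, v)} ω',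
          show SimpleGraph.fromEdgeSet {s(u, v)} = SimpleGraph.edge u v from rfl,
          show SimpleGraph.edge u v ⊔ SimpleGraph.fromEdgeSet ω' ⊔ wired B =
            SimpleGraph.fromEdgeSet ω' ⊔ wired B ⊔ SimpleGraph.edge u v from by
              rw [sup_comm (SimpleGraph.edge u v), sup_right_comm]]
        exact card_connectedComponent_le_sup_edge_add_one _ u v
    have := hstep (ω ∪ ↑T)
    rw [← Set.union_insert] at this
    omega

/-- Elementary exponent bookkeeping for the finite-energy comparison of two cylinder weights. -/
private theorem pow_mul_pow_mul_min_pow_le {p : ℝ} (hp0 : 0 ≤ p) (hp1 : p ≤ 1)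
    {a c c₀ n x x₀ : ℕ} (hc : c ≤ n) (hc₀ : c₀ ≤ n) (hx : x + c = x₀ + c₀) (hnx : n ≤ x + c) :
    p ^ (a + c) * (1 - p) ^ x * (min p (1 - p)) ^ n ≤ p ^ (a + c₀) * (1 - p) ^ x₀ := by
  set m := min p (1 - p) with hm
  have hm0 : 0 ≤ m := le_min hp0 (sub_nonneg.2 hp1)
  have hq0 : 0 ≤ 1 - p := sub_nonneg.2 hp1
  have hq1 : 1 - p ≤ 1 := sub_le_self _ hp0
  obtain ⟨d, hd, hd₀⟩ : ∃ d, x = d + (n - c) ∧ x₀ = d + (n - c₀) := ⟨x + c - n, by omega, by omega⟩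
  rw [hd, hd₀, pow_add, pow_add, pow_add, pow_add]
  have key : p ^ c * (1 - p) ^ (n - c) * m ^ n ≤ p ^ c₀ * (1 - p) ^ (n - c₀) := by
    calc p ^ c * (1 - p) ^ (n - c) * m ^ n ≤ 1 * 1 * m ^ n := by
          gcongr
          · exact pow_le_one₀ hp0 hp1
          · exact pow_le_one₀ hq0 hq1
      _ = m ^ c₀ * m ^ (n - c₀) := by rw [one_mul, one_mul, ← pow_add, Nat.add_sub_cancel' hc₀]
      _ ≤ p ^ c₀ * (1 - p) ^ (n - c₀) :=
          mul_le_mul (pow_le_pow_left₀ hm0 (min_le_left _ _) _)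
            (pow_le_pow_left₀ hm0 (min_le_right _ _) _) (pow_nonneg hm0 _) (pow_nonneg hp0 _)
  calc p ^ a * p ^ c * ((1 - p) ^ d * (1 - p) ^ (n - c)) * m ^ n
      = p ^ a * (1 - p) ^ d * (p ^ c * (1 - p) ^ (n - c) * m ^ n) := by ring
    _ ≤ p ^ a * (1 - p) ^ d * (p ^ c₀ * (1 - p) ^ (n - c₀)) :=
        mul_le_mul_of_nonneg_left key (mul_nonneg (pow_nonneg hp0 _) (pow_nonneg hq0 _))
    _ = p ^ a * p ^ c₀ * ((1 - p) ^ d * (1 - p) ^ (n - c₀)) := by ring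

/-- **Comparison of two cylinder weights** over a region `D = E(G) ∖ U`: for `η ⊆ U` and
`ζ, ζ₀ ⊆ D`, `w(η ∪ ζ) · m^{#D} ≤ q^{#D} · w(η ∪ ζ₀)` with `m = min(p, 1-p)`, `q ≥ 1` (the local
factors differ by at most `m^{-#D}`, the cluster counts by at most `#D`). -/
private theorem rcWeight_union_mul_pow_le {p q : ℝ} (hp : p ∈ Set.Icc (0 : ℝ) 1) (hq : 1 ≤ q)
    (B : Set V) {U η ζ ζ₀ : Finset (Sym2 V)} (hU : U ⊆ G.edgeFinset) (hη : η ⊆ U)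
    (hζ : ζ ⊆ G.edgeFinset \ U) (hζ₀ : ζ₀ ⊆ G.edgeFinset \ U) :
    rcWeight G p q B (η ∪ ζ) * (min p (1 - p)) ^ #(G.edgeFinset \ U) ≤
      q ^ #(G.edgeFinset \ U) * rcWeight G p q B (η ∪ ζ₀) := by
  have hq0 : 0 ≤ q := zero_le_one.trans hq
  have hηE : η ⊆ G.edgeFinset := hη.trans hU
  have hdisj : Disjoint η ζ := Finset.disjoint_of_subset_right hζ
    (Finset.disjoint_of_subset_left hη Finset.disjoint_sdiff)
  have hdisj₀ : Disjoint η ζ₀ := Finset.disjoint_of_subset_right hζ₀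
    (Finset.disjoint_of_subset_left hη Finset.disjoint_sdiff)
  have hζE : η ∪ ζ ⊆ G.edgeFinset := Finset.union_subset hηE (hζ.trans Finset.sdiff_subset)
  have hζ₀E : η ∪ ζ₀ ⊆ G.edgeFinset := Finset.union_subset hηE (hζ₀.trans Finset.sdiff_subset)
  -- cardinalities
  have hcU : #(G.edgeFinset \ U) + #U = #G.edgeFinset := Finset.card_sdiff_add_card_eq_card hU
  have hc1 : #(G.edgeFinset \ (η ∪ ζ)) + #(η ∪ ζ) = #G.edgeFinset :=
    Finset.card_sdiff_add_card_eq_card hζE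
  have hc2 : #(G.edgeFinset \ (η ∪ ζ₀)) + #(η ∪ ζ₀) = #G.edgeFinset :=
    Finset.card_sdiff_add_card_eq_card hζ₀E
  have hu1 : #(η ∪ ζ) = #η + #ζ := Finset.card_union_of_disjoint hdisj
  have hu2 : #(η ∪ ζ₀) = #η + #ζ₀ := Finset.card_union_of_disjoint hdisj₀
  have hζn : #ζ ≤ #(G.edgeFinset \ U) := Finset.card_le_card hζ
  have hζ₀n : #ζ₀ ≤ #(G.edgeFinset \ U) := Finset.card_le_card hζ₀
  have hηU : #η ≤ #U := Finset.card_le_card hη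
  have hx : #(G.edgeFinset \ (η ∪ ζ)) + #ζ = #(G.edgeFinset \ (η ∪ ζ₀)) + #ζ₀ := by omega
  have hnx : #(G.edgeFinset \ U) ≤ #(G.edgeFinset \ (η ∪ ζ)) + #ζ := by omega
  -- the `p`-part
  have hA : p ^ #(η ∪ ζ) * (1 - p) ^ #(G.edgeFinset \ (η ∪ ζ)) *
      (min p (1 - p)) ^ #(G.edgeFinset \ U) ≤
      p ^ #(η ∪ ζ₀) * (1 - p) ^ #(G.edgeFinset \ (η ∪ ζ₀)) := by
    rw [hu1, hu2]
    exact pow_mul_pow_mul_min_pow_le hp.1 hp.2 hζn hζ₀n hx hnx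
  -- the `q`-part
  have hk : clusterCount (↑(η ∪ ζ) : BondConfig V) B ≤
      clusterCount (↑(η ∪ ζ₀) : BondConfig V) B + #(G.edgeFinset \ U) := by
    have h1 : clusterCount (↑(η ∪ ζ) : BondConfig V) B ≤ clusterCount (↑η : BondConfig V) B :=
      clusterCount_anti (by rw [Finset.coe_union]; exact Set.subset_union_left) B
    have h2 := clusterCount_le_clusterCount_union_add_card (↑η : BondConfig V) B ζ₀
    rw [← Finset.coe_union] at h2
    omega
  have hB : q ^ clusterCount (↑(η ∪ ζ) : BondConfig V) B ≤
      q ^ #(G.edgeFinset \ U) * q ^ clusterCount (↑(η ∪ ζ₀) : BondConfig V) B := by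
    rw [← pow_add, add_comm]
    exact pow_le_pow_right₀ hq hk
  have hm0 : 0 ≤ min p (1 - p) := le_min hp.1 (sub_nonneg.2 hp.2)
  unfold rcWeight
  calc p ^ #(η ∪ ζ) * (1 - p) ^ #(G.edgeFinset \ (η ∪ ζ)) *
        q ^ clusterCount (↑(η ∪ ζ) : BondConfig V) B * min p (1 - p) ^ #(G.edgeFinset \ U)
      = (p ^ #(η ∪ ζ) * (1 - p) ^ #(G.edgeFinset \ (η ∪ ζ)) * min p (1 - p) ^ #(G.edgeFinset \ U)) *
          q ^ clusterCount (↑(η ∪ ζ) : BondConfig V) B := by ring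
    _ ≤ (p ^ #(η ∪ ζ₀) * (1 - p) ^ #(G.edgeFinset \ (η ∪ ζ₀))) *
          (q ^ #(G.edgeFinset \ U) * q ^ clusterCount (↑(η ∪ ζ₀) : BondConfig V) B) :=
        mul_le_mul hA hB (pow_nonneg hq0 _)
          (mul_nonneg (pow_nonneg hp.1 _) (pow_nonneg (sub_nonneg.2 hp.2) _))
    _ = q ^ #(G.edgeFinset \ U) * (p ^ #(η ∪ ζ₀) * (1 - p) ^ #(G.edgeFinset \ (η ∪ ζ₀)) *
          q ^ clusterCount (↑(η ∪ ζ₀) : BondConfig V) B) := by ring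

/-- **Finite energy for cylinder events** (insertion AND deletion tolerance of the random-cluster
measure, here in the crude product form): for `0 ≤ p ≤ 1`, `q ≥ 1`, a region `U ⊆ E(G)` and a
prescribed configuration `ζ₀` of the edges OFF `U`, the probability that the configuration off
`U` is exactly `ζ₀` is at least `(min(p,1-p) / (2q))^{#(E(G) ∖ U)}`. -/
theorem rcMeasure_real_cylinder_ge' {p q : ℝ} (hp : p ∈ Set.Icc (0 : ℝ) 1) (hq : 1 ≤ q)
    (B : Set V) {U ζ₀ : Finset (Sym2 V)} (hU : U ⊆ G.edgeFinset) (hζ₀ : ζ₀ ⊆ G.edgeFinset \ U) :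
    (min p (1 - p) / (2 * q)) ^ #(G.edgeFinset \ U) ≤
      (rcMeasure G p q B).real {ω | ω ∩ (↑U : Set (Sym2 V))ᶜ = ↑ζ₀} := by
  have hq0 : 0 < q := one_pos.trans_le hq
  have hZ := rcPartitionFunction_pos G hp hq0 B
  have hm0 : 0 ≤ min p (1 - p) := le_min hp.1 (sub_nonneg.2 hp.2)
  -- numerator
  have hnum : rcPartitionFunction G p q B *
      (rcMeasure G p q B).real {ω | ω ∩ (↑U : Set (Sym2 V))ᶜ = ↑ζ₀} =
      ∑ η ∈ U.powerset, rcWeight G p q B (η ∪ ζ₀) := by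
    have h := rcPartitionFunction_mul_real_inter_cylinder G hp hq0 B hU hζ₀ Set.univ
    simp only [Set.mem_univ, Set.setOf_true, Set.univ_inter, if_true, mul_one] at h
    exact h
  -- denominator
  have hden : rcPartitionFunction G p q B * min p (1 - p) ^ #(G.edgeFinset \ U) ≤
      (2 * q) ^ #(G.edgeFinset \ U) * ∑ η ∈ U.powerset, rcWeight G p q B (η ∪ ζ₀) := by
    rw [rcPartitionFunction, sum_powerset_edgeFinset_split G U hU, Finset.sum_mul, Finset.mul_sum]
    refine Finset.sum_le_sum fun η hη => ?_
    rw [Finset.mem_powerset] at hη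
    rw [Finset.sum_mul]
    calc ∑ ζ ∈ (G.edgeFinset \ U).powerset,
          rcWeight G p q B (η ∪ ζ) * min p (1 - p) ^ #(G.edgeFinset \ U)
        ≤ ∑ ζ ∈ (G.edgeFinset \ U).powerset,
            q ^ #(G.edgeFinset \ U) * rcWeight G p q B (η ∪ ζ₀) :=
          Finset.sum_le_sum fun ζ hζ =>
            rcWeight_union_mul_pow_le G hp hq B hU hη (Finset.mem_powerset.1 hζ) hζ₀
      _ = (2 * q) ^ #(G.edgeFinset \ U) * rcWeight G p q B (η ∪ ζ₀) := by
          rw [Finset.sum_const, Finset.card_powerset, nsmul_eq_mul, mul_pow]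
          push_cast
          ring
  rw [hnum.symm] at hden
  have h2q : 0 < (2 * q) ^ #(G.edgeFinset \ U) := pow_pos (by linarith) _
  rw [div_pow, div_le_iff₀ h2q]
  have := le_of_mul_le_mul_left (a := rcPartitionFunction G p q B)
    (b := min p (1 - p) ^ #(G.edgeFinset \ U))
    (c := (2 * q) ^ #(G.edgeFinset \ U) *
      (rcMeasure G p q B).real {ω | ω ∩ (↑U : Set (Sym2 V))ᶜ = ↑ζ₀})
    (by calc rcPartitionFunction G p q B * min p (1 - p) ^ #(G.edgeFinset \ U) ≤ _ := hden
          _ = _ := by ring) hZ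
  linarith

/-- Additivity of the random-cluster probabilities over two disjoint events (the measure is an
explicit finite sum of point masses; no measurability needed). -/
private theorem rcMeasure_real_union_of_disjoint {p q : ℝ} (hp : p ∈ Set.Icc (0 : ℝ) 1)
    (hq : 0 < q) (B : Set V) {A A' : Set (BondConfig V)} (h : Disjoint A A') :
    (rcMeasure G p q B).real (A ∪ A') =
      (rcMeasure G p q B).real A + (rcMeasure G p q B).real A' := by
  rw [rcMeasure_real_apply G hp hq B (A ∪ A'), rcMeasure_real_apply G hp hq B A,
    rcMeasure_real_apply G hp hq B A', ← Finset.sum_add_distrib]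
  refine Finset.sum_congr rfl fun ω _ => ?_
  by_cases hA : (↑ω : BondConfig V) ∈ A
  · have hA' : (↑ω : BondConfig V) ∉ A' := Set.disjoint_left.1 h hA
    simp [hA, hA']
  · by_cases hA' : (↑ω : BondConfig V) ∈ A'
    · simp [hA, hA']
    · simp [hA, hA']

end FiniteEnergy

/-! ### Single-site holes are opaque on any finite graph carrying two witness paths -/

section SingleSite

variable {V : Type*}

/-- The starting point of a nontrivial connection by edges of `P` lies on an edge of `P`. -/
private theorem exists_mem_of_fromEdgeSet_reachable {P : Finset (Sym2 V)} {a k : V}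
    (h : (SimpleGraph.fromEdgeSet (↑P : Set (Sym2 V))).Reachable a k) (hak : a ≠ k) :
    ∃ f ∈ P, a ∈ f := by
  obtain ⟨w⟩ := h
  cases w with
  | nil => exact absurd rfl hak
  | cons hadj w' =>
    rw [SimpleGraph.fromEdgeSet_adj] at hadj
    exact ⟨_, hadj.1, Sym2.mem_mk_left _ _⟩

variable [Fintype V] [DecidableEq V] (G : SimpleGraph V) [DecidableRel G.Adj]

/-- **A single-site hole crossed by two witness paths is opaque** (pure random-cluster statement,
any finite graph, `0 < p < 1`, `q ≥ 1`).  Let `a, b ≠ k`, and let `P₁` (joining `a` to `k`) and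
`P₂` (joining `k` to `b`) be edge sets touching only in `k`, inside a set `S ⊆ E(G)` of edges that
contains every edge of `G` at a vertex touched by `P₁ ∪ P₂`.  Then deleting the edges at `k`
depresses the connection probability by a definite factor:
`φ_{G∖k}(a ↔ b) ≤ (1 − (min(p,1−p)/(2q))^{#S}) · φ_G(a ↔ b)`.
Proof: `φ_{G∖k}(a↔b) ≤ φ_G(a ↔ b off k)` (closed-outside domain Markov property and FKG,
`rcMeasure_fromEdgeSet_real_le`), and the cylinder event "the configuration on `S` is exactly
`P₁ ∪ P₂`" (finite energy, `rcMeasure_real_cylinder_ge'`) lies in `{a ↔ b}` but is disjoint from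
`{a ↔ b off k}`: an open path from `a` avoiding `k` never leaves the vertices of `P₁`. -/
theorem rcMeasure_holedGraph_singleton_le {p q : ℝ} (hp : p ∈ Set.Ioo (0 : ℝ) 1) (hq : 1 ≤ q)
    {a b k : V} (hak : a ≠ k) (hbk : b ≠ k) {P₁ P₂ S : Finset (Sym2 V)}
    (hS : S ⊆ G.edgeFinset) (h₁ : P₁ ⊆ S) (h₂ : P₂ ⊆ S)
    (htouch : ∀ e ∈ G.edgeFinset, ∀ u ∈ e, ((∃ f ∈ P₁, u ∈ f) ∨ (∃ f ∈ P₂, u ∈ f)) → e ∈ S)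
    (hr₁ : (SimpleGraph.fromEdgeSet (↑P₁ : Set (Sym2 V))).Reachable a k)
    (hr₂ : (SimpleGraph.fromEdgeSet (↑P₂ : Set (Sym2 V))).Reachable k b)
    (hdisj : ∀ u : V, (∃ f ∈ P₁, u ∈ f) → (∃ f ∈ P₂, u ∈ f) → u = k) :
    (rcMeasure (holedGraph G {k}) p q ∅).real (openConn a b) ≤
      (1 - (min p (1 - p) / (2 * q)) ^ #S) * (rcMeasure G p q ∅).real (openConn a b) := by
  have hp' : p ∈ Set.Icc (0 : ℝ) 1 := ⟨hp.1.le, hp.2.le⟩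
  have hq0 : 0 < q := one_pos.trans_le hq
  haveI := isProbabilityMeasure_rcMeasure G hp' hq0 ∅
  -- the region off the hole: the edges of `G` not at `k`
  obtain ⟨U, hGU, hUdef⟩ : ∃ U : Finset (Sym2 V),
      SimpleGraph.fromEdgeSet (↑U : Set (Sym2 V)) = holedGraph G {k} ∧
        ∀ e, e ∈ U ↔ e ∈ G.edgeFinset ∧ ∀ v ∈ ({k} : Set V), v ∉ e :=
    ⟨_, fromEdgeSet_filter_eq_holedGraph G {k}, fun e => @Finset.mem_filter _ _ (_) _ _⟩
  have hUmem : ∀ e, e ∈ U → e ∈ G.edgeFinset ∧ k ∉ e := fun e he =>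
    ⟨((hUdef e).1 he).1, ((hUdef e).1 he).2 k rfl⟩
  have hU : U ⊆ G.edgeFinset := fun e he => (hUmem e he).1
  -- Step 1: the holed measure is dominated by "connected off `k`" in `G`
  have h0 : 0 < (rcMeasure G p q ∅).real {ω | ω ∩ (↑U : Set (Sym2 V))ᶜ = ∅} :=
    rcMeasure_real_offClosed_pos G ⟨hp'.1, hp.2⟩ hq0 ∅ U
  have step1 : (rcMeasure (holedGraph G {k}) p q ∅).real (openConn a b) ≤
      (rcMeasure G p q ∅).real {ω | ω ∩ ↑U ∈ openConn a b} := by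
    have hle := rcMeasure_fromEdgeSet_real_le G hp' hq ∅ U hU h0 (isUpperSet_openConn a b)
    exact (congrArg (fun μ : Measure (BondConfig V) => μ.real (openConn a b))
      (rcMeasure_congr_graph hGU.symm p q ∅)).trans_le hle
  -- Step 2: the witness cylinder and its probability
  have hSS : G.edgeFinset \ (G.edgeFinset \ S) = S := Finset.sdiff_sdiff_eq_self hS
  have hPS : P₁ ∪ P₂ ⊆ G.edgeFinset \ (G.edgeFinset \ S) := by
    rw [hSS]
    exact Finset.union_subset h₁ h₂
  have hFge : (min p (1 - p) / (2 * q)) ^ #S ≤ (rcMeasure G p q ∅).real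
      {ω | ω ∩ (↑(G.edgeFinset \ S) : Set (Sym2 V))ᶜ = ↑(P₁ ∪ P₂)} := by
    have := rcMeasure_real_cylinder_ge' G hp' hq ∅ (U := G.edgeFinset \ S)
      Finset.sdiff_subset hPS
    rwa [hSS] at this
  -- Step 3: the cylinder lies in `{a ↔ b}`
  have hFsub : ∀ ω : BondConfig V, ω ∩ (↑(G.edgeFinset \ S) : Set (Sym2 V))ᶜ = ↑(P₁ ∪ P₂) →
      (↑P₁ : Set (Sym2 V)) ⊆ ω ∧ (↑P₂ : Set (Sym2 V)) ⊆ ω := by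
    intro ω hω
    have h : (↑(P₁ ∪ P₂) : Set (Sym2 V)) ⊆ ω := hω ▸ Set.inter_subset_left
    rw [Finset.coe_union] at h
    exact ⟨Set.subset_union_left.trans h, Set.subset_union_right.trans h⟩
  have hF1 : {ω : BondConfig V | ω ∩ (↑(G.edgeFinset \ S) : Set (Sym2 V))ᶜ = ↑(P₁ ∪ P₂)} ⊆
      openConn a b := by
    intro ω hω
    obtain ⟨hω1, hω2⟩ := hFsub ω hω
    exact (hr₁.mono (SimpleGraph.fromEdgeSet_mono hω1)).trans
      (hr₂.mono (SimpleGraph.fromEdgeSet_mono hω2))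
  -- Step 4: ... but is disjoint from "connected off `k`"
  have hF2 : Disjoint {ω : BondConfig V | ω ∩ ↑U ∈ openConn a b}
      {ω | ω ∩ (↑(G.edgeFinset \ S) : Set (Sym2 V))ᶜ = ↑(P₁ ∪ P₂)} := by
    rw [Set.disjoint_left]
    intro ω hA hωF
    have hA' : (openGraph (ω ∩ ↑U)).Reachable a b := hA
    obtain ⟨w⟩ := hA'
    suffices H : ∀ (x y : V) (w' : (openGraph (ω ∩ ↑U)).Walk x y),
        (∃ f ∈ P₁, x ∈ f) → x ≠ k → (∃ f ∈ P₁, y ∈ f) ∧ y ≠ k by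
      obtain ⟨hb1, -⟩ := H a b w (exists_mem_of_fromEdgeSet_reachable hr₁ hak) hak
      exact hbk (hdisj b hb1 (exists_mem_of_fromEdgeSet_reachable hr₂.symm hbk))
    intro x y w'
    induction w' with
    | nil => exact fun h1 h2 => ⟨h1, h2⟩
    | @cons x z y hadj w'' ih =>
      intro hx hxk
      rw [openGraph_adj] at hadj
      obtain ⟨⟨hω, hUz⟩, hxz⟩ := hadj
      obtain ⟨hE, hkz⟩ := hUmem _ (Finset.mem_coe.1 hUz)
      have hxzS : s(x, z) ∈ S := htouch _ hE x (Sym2.mem_mk_left x z) (Or.inl hx)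
      have hP : s(x, z) ∈ P₁ ∪ P₂ := by
        have : s(x, z) ∈ ω ∩ (↑(G.edgeFinset \ S) : Set (Sym2 V))ᶜ := by
          refine ⟨hω, ?_⟩
          rw [Set.mem_compl_iff, Finset.mem_coe, Finset.mem_sdiff, not_and, not_not]
          exact fun _ => hxzS
        rw [hωF] at this
        exact_mod_cast this
      rcases Finset.mem_union.1 hP with hP1 | hP2
      · refine ih ⟨_, hP1, Sym2.mem_mk_right x z⟩ fun hzk => ?_
        exact hkz (hzk ▸ Sym2.mem_mk_right x z)
      · exact absurd (hdisj x hx ⟨_, hP2, Sym2.mem_mk_left x z⟩) hxk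
  -- Step 5: bookkeeping
  have hA'sub : {ω : BondConfig V | ω ∩ ↑U ∈ openConn a b} ⊆ openConn a b :=
    fun ω h => isUpperSet_openConn a b Set.inter_subset_left h
  have hsum : (rcMeasure G p q ∅).real {ω | ω ∩ ↑U ∈ openConn a b} +
      (rcMeasure G p q ∅).real {ω | ω ∩ (↑(G.edgeFinset \ S) : Set (Sym2 V))ᶜ = ↑(P₁ ∪ P₂)} ≤
      (rcMeasure G p q ∅).real (openConn a b) := by
    rw [← rcMeasure_real_union_of_disjoint G hp' hq0 ∅ hF2]
    exact measureReal_mono (Set.union_subset hA'sub hF1) (measure_ne_top _ _)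
  have hC1 : (rcMeasure G p q ∅).real (openConn a b) ≤ 1 := by
    calc (rcMeasure G p q ∅).real (openConn a b) ≤ (rcMeasure G p q ∅).real Set.univ :=
          measureReal_mono (Set.subset_univ _) (measure_ne_top _ _)
      _ = 1 := probReal_univ
  have hc0 : 0 ≤ (min p (1 - p) / (2 * q)) ^ #S :=
    pow_nonneg (div_nonneg (le_min hp'.1 (sub_nonneg.2 hp'.2)) (by linarith)) _
  have hC0 : 0 ≤ (rcMeasure G p q ∅).real (openConn a b) := measureReal_nonneg
  nlinarith [step1, hsum, hFge, hC1, mul_le_mul_of_nonneg_left hC1 hc0]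

end SingleSite

/-- STUB SINGLE-SITE-HOLE (registered stub `stub_singleSiteHole` of the skeleton
`Cruxes/FKFourConnectivity/Lines/cluster-hole-opacity.lean`, crux `FKFourConnectivity`,
stmt-CriticalPhenomena-11254) — **a single holed site depresses the random-cluster connection
probability by a definite factor**, on an arbitrary finite graph: for `0 < p < 1`, `q ≥ 1`,
`a, b ≠ k`, edge sets `P₁ ∋ (a ↔ k)`, `P₂ ∋ (k ↔ b)` touching only at `k`, inside `S ⊆ E(G)`
containing every edge of `G` at a vertex touched by `P₁ ∪ P₂`,
`φ_{holedGraph G {k}}(a ↔ b) ≤ (1 − (min(p,1−p)/(2q))^{#S}) · φ_G(a ↔ b)`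
(closed-outside domain Markov property + FKG + finite energy + path confinement; binder form of
`rcMeasure_holedGraph_singleton_le`). -/
theorem stub_singleSiteHole :
    ∀ (V : Type) [Fintype V] [DecidableEq V] (G : SimpleGraph V) [DecidableRel G.Adj] (p q : ℝ),
      p ∈ Set.Ioo (0 : ℝ) 1 → 1 ≤ q → ∀ (a b k : V), a ≠ k → b ≠ k →
        ∀ (P₁ P₂ S : Finset (Sym2 V)), S ⊆ G.edgeFinset → P₁ ⊆ S → P₂ ⊆ S →
          (∀ e ∈ G.edgeFinset, ∀ u ∈ e, ((∃ f ∈ P₁, u ∈ f) ∨ (∃ f ∈ P₂, u ∈ f)) → e ∈ S) →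
          (SimpleGraph.fromEdgeSet (↑P₁ : Set (Sym2 V))).Reachable a k →
          (SimpleGraph.fromEdgeSet (↑P₂ : Set (Sym2 V))).Reachable k b →
          (∀ u : V, (∃ f ∈ P₁, u ∈ f) → (∃ f ∈ P₂, u ∈ f) → u = k) →
            (rcMeasure (holedGraph G {k}) p q ∅).real (openConn a b) ≤
              (1 - (min p (1 - p) / (2 * q)) ^ #S) * (rcMeasure G p q ∅).real (openConn a b) := by
  intro V _ _ G _ p q hp hq a b k hak hbk P₁ P₂ S hS h₁ h₂ htouch hr₁ hr₂ hdisj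
  exact rcMeasure_holedGraph_singleton_le G hp hq hak hbk hS h₁ h₂ htouch hr₁ hr₂ hdisj

end Summit.CriticalPhenomena.Ising3DConformalLimit.Cruxes.FKFourConnectivity.ClusterHoleOpacity

end
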